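import Mathlib
import Summits.HodgeConjecture.HodgeConjecture.Theorems.HodgeLocusCensusValJ1728At2Genus

/-!
# Hodge-locus census, V3-XT `N = 1`: THEOREM R — the normalisation supplement of the genus laws at `2` and `3` (finite core and anchors)

HONEST FRAMING: certified instances and evidence bearing on the general Hodge conjecture; no claim.

Setting and notation as in `HodgeLocusCensusValJ1728At2Genus` (abs-1 gen 25, genus law G2 at `ℓ = 2`: `D = -4N`,
`N ≡ 1 (mod 8)`, type sign `ε = ±1` of a CM class, `ε(𝔞 ∗ E) = χ₋₄(N𝔞) ε(E)`) and `HodgeLocusCensusValJ0At3Genus`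
(gen 24, law (G) at `ℓ = 3`: `v₃(D) = 1`, `M = |D|/3 ≡ 1 (mod 3)`, `ε₃ = z₀²`, `ε₃(𝔞 ∗ E) = χ₋₃(N𝔞) ε₃(E)`).
Those laws fix the types up to ONE global sign per prime `𝔓`; the supplement (R) naming that sign ("at the
embedding `√n' ↦ +S`, `S ≡ 1 (mod 4)`, the coset `γ₊` of the principal class is HIGH iff `χ₋₄(k) = +1`",
`N = k² n'`; at `3`: iff `k ≡ 1 (mod 3)`) was OBSERVED without exception by two seats (590 + 1058
discriminants, `|D| ≤ 2·10⁴`) but not derived.  THEOREM R (derivation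
`code/abs_engineA/xt/n1recip/DERIVATION-R-A.md`, abs-1 gen 26) gives the type of every class at every prime:

  `ℓ = 2`:  `ε_𝔓(E_𝔞) = σ_𝔓 · χ₋₄(N𝔞)`,  i.e.  `T_𝔓(E_𝔞) ≥ 20 ⟺ 𝔓(√N₊) ≡ N𝔞 (mod 4)`;
  `ℓ = 3`:  `ε₃,𝔓(E_𝔞) = σ_𝔓 · χ₋₃(N𝔞)`, i.e.  `v'_𝔓(j(E_𝔞)) ≥ 9 ⟺ 𝔓(√M₊) ≡ N𝔞 (mod 3)`,

where `E_𝔞 = ℂ/𝔞` for the proper ideal `𝔞 = [A, (-B+√D)/2]` of the form `(A, B, C)`, `A = N𝔞` odd (resp. prime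
to `3`), `√N₊ > 0` the real root and `σ_𝔓 = +1` iff the embedding `𝔓` sends `√N₊` to the `2`-adic root
`S_N ≡ 1 (mod 4)` (resp. `√M₊` to `S_M ≡ 1 (mod 3)`).  (R), (R)₃, the square cases and the class forms G2(a)/(G)
are corollaries.  DERIVATION (nothing of this paragraph is formalised; inputs [cite: Gross1986CanonicalLiftings] as
recalled in [cite: KudlaRapoportYang2006, (3.6.10)–(3.6.13), (7.7.9)–(7.7.10)], [cite: SilvermanAEC2009, III.8.1–8.2],
[cite: SilvermanATAEC1994, I Ex. 1.15], [cite: DiamondShurman2005, §1.3, §7.4], [cite: Tate1967, §2]):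
(1) on `E_𝔞`, `√-N ω₁ = (B/2) ω₁ + A ω₂`, so the Weil pairing `e₄(x, √-N x) = i^{λA}` for every `O/4`-generator
`x` of `E_𝔞[4]` (`λ = ±1` universal, unit norms `≡ 1 (mod 4)`), and `e₄(P, [i]P) = i^λ` on `E₁ : y² = x³ - x`;
(2) the `2`-divisible groups of `E_𝔞` and `E₁` are formal `ℤ₂[i]`-modules (`√-N ↦ σ S_N i`) of the same Lie type,
hence isomorphic over `𝒪 ⊇ W(𝔽̄₂)[i]` by the uniqueness of the canonical lift: `Φ θ(√-N) Φ⁻¹ = σ S_N [i]`;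
(3) reducing, `y₀ = red θ(√-N) = σ S_N · u⁻¹ I₀ u` with `u = b⁻¹Φ̄ ∈ End(Ḡ)^× = 𝓗₂^×`, `I₀ ∈ {±I, ±J, ±K}`, so
`ε(E_𝔞) = χ₋₄(Nrd u)` by the flip rule; (4) the multiplier of `Φ` on Weil pairings is `ν = u†u = Nrd u`
(polarisations reduce, Rosati = dual isogeny = quaternion conjugation); (5) comparing `e^1(Φx, Φθx) = i^{λσS_N} = i^{λσ}`
(`S_N ≡ 1 (mod 4)`: the only place the normalisation enters) with `e^𝔞(x, θx)^ν = i^{λAν}` gives `ν ≡ σA (mod 4)`,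
whence the law; at `3` the same with `E^{(ρ)}`, `2[ρ]+1 = √-3`, `√D ω₁ = B ω₁ + 2A ω₂`, `e₃`, `χ₋₃`.

THIS FILE (kernel-checked): the `θ`-matrix and determinant identities of step (1) at `2` and `3`; the unit-norm /
form-value congruences making the pairing exponent generator-independent; the dictionary step (5) as implications
over `ℤ/4` and `ℤ/3` (`theoremR_two`, `theoremR_three`) with its reading `HIGH ⟺ σ ≡ N𝔞`; the instances of the two
flip rules at `I₀`, `Y₀` (`typeI0_conj`, `typeY0_conj`); the corollary identities (base case = (R), square case
`σ = χ(f)`, reduction `σ(N) = χ₋₄(k) σ(n')`); and two census anchors pinning the sign conventions: `D = -68` at `2`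
(against `ValJ1728At2Genus.anchor_coset_profile_68`) and the new `ℓ = 3` anchor `D = -39` (exact factorisation
`H_{-39} = γ₊ γ₋` over `ℤ[(1+√13)/2]` and its `3`-adic profile at `√13 ↦ +S`: `γ₊` HIGH, `γ₋` MIN, as THEOREM R predicts;
certificate `impl2_genusfactor.py 3 -39`, engine A).  CERTIFIED content of THEOREM R = the two-seat coset profiles
(525/65 at `2`, 623/435 at `3`, 0 exceptions).
-/

namespace Summit.HodgeConjecture.HodgeConjecture.HodgeLocus.Census.GenusReciprocity

open Summit.HodgeConjecture.HodgeConjecture.HodgeLocus.Census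
open ValJ1728At2Genus

/-! ### Step (1) at `ℓ = 2`: the matrix of `√-N` on `𝔞 = ℤω₁ + ℤω₂`, `ω₁ = A`, `ω₂ = -B/2 + √-N` -/

/-- With `B = 2B'` and `B'² - AC = -N`: `√-N ω₁ = B' ω₁ + A ω₂`, `√-N ω₂ = -C ω₁ - B' ω₂`, and this matrix squares
to `-N` (entries of `Θ²` for `Θ = [[B', A], [-C, -B']]`, row convention). -/
theorem theta_matrix_sq (A B' C N : ℤ) (h : B' ^ 2 - A * C = -N) :
    B' * B' + A * (-C) = -N ∧ B' * A + A * (-B') = 0 ∧ (-C) * B' + (-B') * (-C) = 0 ∧ (-C) * A + (-B') * (-B') = -N := by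
  refine ⟨?_, by ring, by ring, ?_⟩ <;> linear_combination h

/-- The Weil-pairing exponent of `(x, √-N x)` for `x = p ω₁ + q ω₂`: `det(x, Θx) = A p² - 2B' p q + C q² = f(p, -q)`,
a value of the form `f = (A, 2B', C)`; for `x = ω₁` it is `A = N𝔞`. -/
theorem det_theta_eq_form (A B' C p q : ℤ) :
    p * (p * A - q * B') - q * (p * B' - q * C) = A * p ^ 2 - 2 * B' * p * q + C * q ^ 2 := by ring

/-- Generator independence, form version: odd values of a form `(A, 2B', C)` of discriminant `-4N`, `N ≡ 1 (mod 4)`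
(`AC = B'² + N ≡ B'² + 1`), `A` odd, are all `≡ A (mod 4)` (Gauss's character `χ₋₄` is constant on the form). -/
theorem form_value_mod_four : ∀ A B' C p q : ZMod 4, (A = 1 ∨ A = 3) → A * C = B' ^ 2 + 1 →
    ((A * p ^ 2 - 2 * B' * p * q + C * q ^ 2 = 1 ∨ A * p ^ 2 - 2 * B' * p * q + C * q ^ 2 = 3) →
      A * p ^ 2 - 2 * B' * p * q + C * q ^ 2 = A) := by
  decide

/-- Generator independence, unit version: units of `ℤ[i]/4` (and of `ℤ[√-N]/4`, `N ≡ 1 (mod 4)`: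
`ValJ1728At2Genus.principal_norm_mod_four`) have norm `≡ 1 (mod 4)`, so `e₄(αx, αθx) = e₄(x, θx)^{N(α)} = e₄(x, θx)`. -/
theorem unit_norm_mod_four : ∀ a b : ZMod 4, (a ^ 2 + b ^ 2 = 1 ∨ a ^ 2 + b ^ 2 = 3) → a ^ 2 + b ^ 2 = 1 := by
  decide

/-! ### Step (1) at `ℓ = 3`: `𝔞 = ℤA + ℤ(-B + √D)/2`, `D = B² - 4AC = -3M` -/

/-- `√D ω₁ = B ω₁ + 2A ω₂`, `√D ω₂ = -2C ω₁ - B ω₂`, and the matrix squares to `D`. -/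
theorem theta3_matrix_sq (A B C D : ℤ) (h : B ^ 2 - 4 * A * C = D) :
    B * B + 2 * A * (-2 * C) = D ∧ B * (2 * A) + 2 * A * (-B) = 0 ∧
      (-2 * C) * B + (-B) * (-2 * C) = 0 ∧ (-2 * C) * (2 * A) + (-B) * (-B) = D := by
  refine ⟨?_, by ring, by ring, ?_⟩ <;> linear_combination h

/-- `det(x, √D x) = 2 (A p² - B p q + C q²) = 2 f(p, -q)`; for `x = ω₁` the `e₃`-exponent is `2A`. -/
theorem det_theta3_eq_form (A B C p q : ℤ) :
    p * (2 * p * A - q * B) - q * (p * B - 2 * q * C) = 2 * (A * p ^ 2 - B * p * q + C * q ^ 2) := by ring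

/-- Values prime to `3` of a form of discriminant `≡ 0 (mod 3)` with `3 ∤ A` are `≡ A · □ ≡ A (mod 3)`. -/
theorem form_value_mod_three : ∀ A B C p q : ZMod 3, A ≠ 0 → B ^ 2 = 4 * A * C →
    A * p ^ 2 - B * p * q + C * q ^ 2 ≠ 0 → A * p ^ 2 - B * p * q + C * q ^ 2 = A := by
  decide

/-- Units of `ℤ[ρ]/3 = ℤ₃[√D]/3` have norm `a² - ab + b² ≡ 1 (mod 3)`. -/
theorem unit_norm_mod_three : ∀ a b : ZMod 3, a ^ 2 - a * b + b ^ 2 ≠ 0 → a ^ 2 - a * b + b ^ 2 = 1 := by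
  decide

/-! ### Step (3): the flip rules at `I₀ ∈ {±I, ±J, ±K}` and `Y₀ = ±j` -/

/-- `ℓ = 2`: `I₀` (the transported reduction of `[i]`, a pure unit: `±I, ±J, ±K`) is admissible of sign `+1`, and
for every `u` of odd norm `ε(u I₀ u⁻¹) = χ₋₄(Nrd u)` (`act u y ≡ u y u⁻¹ (mod 4)`); with `ε(±S_N · y) = ε(y)`
(`eps_smul_odd`) this is `ε(y₀) = χ₋₄(Nrd u)` for `y₀ = σ S_N · u⁻¹ I₀ u`. -/
theorem typeI0_conj : ∀ u I₀ : H4, (nrdH u = 1 ∨ nrdH u = 3) →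
    (I₀ = qI ∨ I₀ = -qI ∨ I₀ = qJ ∨ I₀ = -qJ ∨ I₀ = qK ∨ I₀ = -qK) →
      admissible I₀ ∧ eps I₀ = 1 ∧ admissible (act u I₀) ∧ eps (act u I₀) = chi4 (nrdH u) := by
  rintro ⟨a, b, c, d⟩ I₀ hu hI
  rcases hI with rfl | rfl | rfl | rfl | rfl | rfl <;> revert a b c d <;> decide +kernel

/-- `ℓ = 3` (model `F9 = 𝔽₃(i)` of `O₃/Π`, `z = Y j⁻¹`, type HIGH iff `z₀ ∈ 𝔽₃`, `Y' = wYw⁻¹ ⇒ z₀ = z₀' w₀²`):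
`Y₀ = ±j` has `z₀ = ±1 ∈ 𝔽₃` (HIGH), and `u⁻¹ Y₀ u` is HIGH iff `N(u₀) = 1`, i.e. `ε₃(y₀) = χ₋₃(Nrd u)`. -/
theorem typeY0_conj : ∀ z' w : ValJ0At3Genus.F9, w ≠ 0 →
    (ValJ0At3Genus.mul9 z' (ValJ0At3Genus.mul9 w w) = (1, 0) ∨ ValJ0At3Genus.mul9 z' (ValJ0At3Genus.mul9 w w) = (-1, 0)) →
      (z'.2 = 0 ↔ ValJ0At3Genus.nrm w = 1) := by
  decide

/-! ### Step (5): the dictionary — flip-rule output + pairing congruence ⇒ THEOREM R -/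

/-- `χ₋₄` is multiplicative on odd residues. -/
theorem chi4_mul : ∀ m n : ZMod 4, (m = 1 ∨ m = 3) → (n = 1 ∨ n = 3) → chi4 (m * n) = chi4 m * chi4 n := by
  decide

/-- THEOREM R at `2`, dictionary step.  Inputs: `ε(E_𝔞) = χ₋₄(ν)` (`ν = Nrd u`, steps (3)–(4)) and the pairing
congruence `σ ≡ A ν (mod 4)` from `i^{λσ} = i^{λAν}` (step (5); `σ = σ_𝔓 ∈ {±1}`, `A = N𝔞` odd).  Output:
`ε(E_𝔞) = χ₋₄(σ) χ₋₄(A) = σ_𝔓 · χ₋₄(N𝔞)`, and the reading `HIGH (ε = +1) ⟺ σ ≡ N𝔞 (mod 4)`, i.e.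
`T_𝔓(E_𝔞) ≥ 20 ⟺ 𝔓(√N₊) ≡ N𝔞 (mod 4)`. -/
theorem theoremR_two : ∀ ν σ A : ZMod 4, (σ = 1 ∨ σ = 3) → (A = 1 ∨ A = 3) → σ = A * ν →
    chi4 ν = chi4 σ * chi4 A ∧ (chi4 ν = 1 ↔ σ = A) := by
  decide

/-- COROLLARY (i) = SUPPLEMENT (R): the principal class (`N𝔞 = 1`) is HIGH exactly where `σ_𝔓 = +1`, i.e. at the
primes with `𝔓(√N₊) ≡ 1 (mod 4)`. -/
theorem supplementR_base : ∀ ν σ : ZMod 4, (σ = 1 ∨ σ = 3) → σ = 1 * ν → (chi4 ν = 1 ↔ σ = 1) := by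
  decide

/-- COROLLARY (iii), square case `N = f²`: the root of `N` that is `≡ 1 (mod 4)` is `S_N = χ₋₄(f) f`, so
`σ = f / S_N = χ₋₄(f)`; with `χ₋₄ ∘ N` trivial on `Pic` the law reads `ε ≡ χ₋₄(f)` (`ValJ1728At2Genus.square_case`). -/
theorem square_case_sigma : ∀ f : ZMod 4, (f = 1 ∨ f = 3) →
    ((chi4 f : ℤ) : ZMod 4) * f = 1 ∧ f = ((chi4 f : ℤ) : ZMod 4) * (((chi4 f : ℤ) : ZMod 4) * f) := by
  decide

/-- COROLLARY (iv), the reduction step of gen 25 §2(6): for `N = k² n'`, `√N₊ = k √n'₊` and the normalised roots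
satisfy `S_N = χ₋₄(k) k S_{n'}` (the right-hand side is `≡ 1 (mod 4)`), hence `σ(N) = χ₋₄(k) σ(n')`. -/
theorem sigma_reduction : ∀ k S' : ZMod 4, (k = 1 ∨ k = 3) → S' = 1 → ((chi4 k : ℤ) : ZMod 4) * k * S' = 1 := by
  decide

/-- Units of `ℤ/3`: `χ₋₃(n) = (n | 3) = +1` iff `n = 1`; multiplicativity of `χ₋₃` in this form, and
`χ₋₃(-1) = -1` (`-1 = 2` is not `1`). -/
theorem chi3_mul : (∀ m n : ZMod 3, m ≠ 0 → n ≠ 0 → (m * n = 1 ↔ (m = 1 ↔ n = 1))) ∧ (-1 : ZMod 3) ≠ 1 := by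
  decide

/-- THEOREM R at `3`, dictionary step (character-free form: for a unit `n` of `ℤ/3`, `χ₋₃(n) = +1 ⟺ n = 1`).
Inputs: `ε₃(E_𝔞) = χ₋₃(ν)` (`ν = Nrd u`, so HIGH iff `ν ≡ 1`) and `2σ ≡ 2Aν (mod 3)` from `ρ^{2λσ} = ρ^{2λAν}`.
Output: `χ₋₃(ν) = χ₋₃(σ) χ₋₃(A)`, i.e. `ε₃(E_𝔞) = σ_𝔓 · χ₋₃(N𝔞)`, and `HIGH ⟺ σ ≡ N𝔞 (mod 3)`, i.e.
`v'_𝔓(j(E_𝔞)) ≥ 9 ⟺ 𝔓(√M₊) ≡ N𝔞 (mod 3)`. -/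
theorem theoremR_three : ∀ ν σ A : ZMod 3, (σ = 1 ∨ σ = 2) → A ≠ 0 → 2 * σ = 2 * A * ν →
    (ν = 1 ↔ (σ = 1 ↔ A = 1)) ∧ (ν = 1 ↔ σ = A) := by
  decide

/-- (R)₃ and the corollaries at `3`: (i) principal class (`N𝔞 = 1`) HIGH iff `σ = 1` (`𝔓(√M₊) ≡ 1 (mod 3)`);
(iii) `M = f²`: the root `S_M ≡ 1 (mod 3)` of `f²` is `±f` and `σ = f/S_M ≡ f (mod 3)`, so (with `χ₋₃ ∘ N` trivial
on `Pic`) all classes are HIGH iff `f ≡ 1 (mod 3)` (`ValJ0At3Genus.square_case_f`); (iv) `M = k² m'`: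
`S_M ∈ {± k S_{m'}}` is `k S_{m'}` iff `k ≡ 1 (mod 3)`, so `σ(M) = χ₋₃(k) σ(m')`. -/
theorem supplementR3 :
    (∀ ν σ : ZMod 3, (σ = 1 ∨ σ = 2) → 2 * σ = 2 * 1 * ν → (ν = 1 ↔ σ = 1)) ∧
    (∀ f S σ : ZMod 3, f ≠ 0 → S ^ 2 = f ^ 2 → S = 1 → σ * S = f → σ = f) ∧
    (∀ k S' : ZMod 3, k ≠ 0 → S' = 1 → (k * S' = 1 ∨ -(k * S') = 1) ∧ (k * S' = 1 ↔ k = 1)) := by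
  refine ⟨by decide, by decide, by decide⟩

/-! ### Census anchors (sign conventions pinned) -/

/-- `ℓ = 2`, `D = -68`, `N = 17 = n'`, `k = 1`: reduced forms `(1,0,17)`, `(2,2,9) ~ (9,-2,2)` (norms `≡ 1 (mod 4)`:
the coset `γ₊ = ker χ₋₄∘N`, containing the principal class) and `(3,±2,6)` (norm `3`: `γ₋`).  At the embedding
`√17 ↦ s`, `s = 64169705 ≡ 1 (mod 4)` (so `s ≡ S`, `σ = +1`), THEOREM R predicts `γ₊` HIGH and `γ₋` MIN — which is
the certified profile `ValJ1728At2Genus.anchor_coset_profile_68` (`γ₊(x+1728)`: coefficient valuations `(20, 14, 0)`,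
roots `10`, type `T = 20`; `γ₋`: `(18, 12, 0)`, roots `9`, type `18`). -/
theorem anchor_68_prediction :
    (0 : ℤ) ^ 2 - 4 * 1 * 17 = -68 ∧ (-2 : ℤ) ^ 2 - 4 * 9 * 2 = -68 ∧ (2 : ℤ) ^ 2 - 4 * 3 * 6 = -68 ∧
    (64169705 : ℤ) % 4 = 1 ∧
    chi4 ((1 : ℕ) : ZMod 4) = 1 ∧ chi4 ((9 : ℕ) : ZMod 4) = 1 ∧ chi4 ((3 : ℕ) : ZMod 4) = -1 ∧
    -- the law `HIGH ⟺ σ ≡ N𝔞 (mod 4)` at `σ = 1` for the three norms: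
    ((1 : ZMod 4) = ((1 : ℕ) : ZMod 4)) ∧ ((1 : ZMod 4) = ((9 : ℕ) : ZMod 4)) ∧ ¬ ((1 : ZMod 4) = ((3 : ℕ) : ZMod 4)) := by
  refine ⟨by norm_num, by norm_num, by norm_num, by norm_num, ?_⟩
  decide

/-- `ℓ = 3` ANCHOR `D = -39` (`M = 13 = m'`, `k = 1`, `h = 4`): reduced forms `(1,1,10)`, `(3,3,4)` (values `1`, `4`
prime to `3`, `≡ 1 (mod 3)`: the coset `γ₊`, HIGH where `σ = +1` by THEOREM R) and `(2,±1,5)` (value `2 ≢ 1`: `γ₋`).  Over `F = ℚ(√13)`,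
`H_{-39} = x⁴ + 331531596 x³ - 429878960946 x² + 109873509788637459 x + 20919104368024767633 = γ₊ γ₋`,
`γ± = x² + ½(A₁ ± B₁√13) x + ½(A₀ ± B₀√13)`, `A₁ = 331531596`, `B₁ = 91951146`, `A₀ = 63399280527`,
`B₀ = 17399806263` (engine A impl-2, exact recognition; `A_i ≡ B_i (mod 2)`).  The identity `γ₊ γ₋ = H_{-39}`
(`4 H_k = Σ_{i+j=k} (A_i A_j - 13 B_i B_j)`, `A₂ = 2`, `B₂ = 0`): -/
theorem anchor_coset_factorisation_39 :
    (1 : ℤ) ^ 2 - 4 * 1 * 10 = -39 ∧ (3 : ℤ) ^ 2 - 4 * 3 * 4 = -39 ∧ (1 : ℤ) ^ 2 - 4 * 2 * 5 = -39 ∧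
    ((1 : ℕ) : ZMod 3) = 1 ∧ ((4 : ℕ) : ZMod 3) = 1 ∧ ((2 : ℕ) : ZMod 3) ≠ 1 ∧
    (331531596 : ℤ) % 2 = (91951146 : ℤ) % 2 ∧ (63399280527 : ℤ) % 2 = (17399806263 : ℤ) % 2 ∧
    (63399280527 : ℤ) * 63399280527 - 13 * (17399806263 * 17399806263) = 4 * 20919104368024767633 ∧
    2 * ((63399280527 : ℤ) * 331531596) - 13 * (2 * (17399806263 * 91951146)) = 4 * 109873509788637459 ∧
    2 * ((63399280527 : ℤ) * 2) + 331531596 * 331531596 - 13 * (91951146 * 91951146) = 4 * (-429878960946) ∧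
    2 * ((331531596 : ℤ) * 2) = 4 * 331531596 := by
  refine ⟨by norm_num, by norm_num, by norm_num, by decide, by decide, by decide, by norm_num, by norm_num,
    by norm_num, by norm_num, by norm_num, by norm_num⟩

/-- `3`-ADIC PROFILE of the `D = -39` anchor.  `3` splits in `F = ℚ(√13)`; `s = 13926346` satisfies
`s² ≡ 13 (mod 3¹⁵)`, `s ≡ 1 (mod 3)`, so `√13 ↦ s` is the embedding `+S` (`σ = +1`) to precision `3¹⁵` (faithful for
the exponents below, all `≤ 10`).  `γ₊`: `v₃(½(A₀ + B₀ s)) = 9`, `v₃(½(A₁ + B₁ s)) = 6 ≥ 5` ⇒ Newton polygon one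
segment of slope `9/2`: both roots `v₃ = 9/2`, `v' = 9` (HIGH); `γ₋`: `v₃(½(A₀ - B₀ s)) = 6`, `v₃(½(A₁ - B₁ s)) = 3`
⇒ both roots `v₃ = 3`, `v' = 6` (MIN).  This is THEOREM R at `3` for `σ = +1`: classes of norm `≡ 1 (mod 3)` HIGH,
norm `≡ 2` MIN (and (R)₃ with `k = 1`).  At `√13 ↦ -s` the roles swap (same lines with `s ↦ -s`).  Census
(gen 24, engines A/B): `{9, 9, 6, 6}`. -/
theorem anchor_coset_profile_39 :
    let s : ℤ := 13926346
    let A₀ : ℤ := 63399280527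
    let B₀ : ℤ := 17399806263
    let A₁ : ℤ := 331531596
    let B₁ : ℤ := 91951146
    (s ^ 2 - 13) % 3 ^ 15 = 0 ∧ s % 3 = 1 ∧
    -- embedding √13 ↦ +S: γ₊: v₃(A₀ + B₀ s) = 9, v₃(A₁ + B₁ s) = 6
    (3 : ℤ) ^ 9 ∣ A₀ + B₀ * s ∧ ¬ (3 : ℤ) ^ 10 ∣ A₀ + B₀ * s ∧
    (3 : ℤ) ^ 6 ∣ A₁ + B₁ * s ∧ ¬ (3 : ℤ) ^ 7 ∣ A₁ + B₁ * s ∧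
    -- embedding √13 ↦ +S: γ₋: v₃(A₀ - B₀ s) = 6, v₃(A₁ - B₁ s) = 3
    (3 : ℤ) ^ 6 ∣ A₀ - B₀ * s ∧ ¬ (3 : ℤ) ^ 7 ∣ A₀ - B₀ * s ∧
    (3 : ℤ) ^ 3 ∣ A₁ - B₁ * s ∧ ¬ (3 : ℤ) ^ 4 ∣ A₁ - B₁ * s := by
  refine ⟨by norm_num, by norm_num, ?_, ?_, ?_, ?_, ?_, ?_, ?_, ?_⟩ <;> norm_num

end Summit.HodgeConjecture.HodgeConjecture.HodgeLocus.Census.GenusReciprocity
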